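import Summits.QuantumAdvantage.AdviceFreeQNC0.OddPrimeStatements
import HarnessLib

/-!
# Item stmt-QuantumAdvantage-23991 `LocalTwoThirdsLaw` — COMPUTATIONAL CORE of the 4-block blind class game (value `2/3`)

Cell qa-qnc0, route OddPrimeWalk; AUTHORED AND PROVED BY THE PLANNER SEAT qa-qnc0-p2 g29
(`HOME/qa-qnc0-p2/line29/LocalTwoThirds23991.lean` §S3, farm rc 0); landed by qn-prover-3 g18 (ask P2-29g) as a separate
COMPUTATIONAL module: `core4_le` is a `native_decide` evaluation (64³ profile codes × 324 cells, ≈ 85 M Boolean evaluations; axiom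
`Lean.ofReduceBool`), everything else of the item lives in `OddPrimeWalkOddLocal.lean` with standard axioms in its own declarations.
`tr m x` = `Tr(ζ^m·x)` for the code `x ∈ {0,1,2,3}` of `0, ζ⁰, ζ¹, ζ²`; `win4` = win bit of a class cell under three block profiles and
the last output; `core4_le`: every profile wins at most `54` of the `81` class cells in best-response form.
WHAT THIS IS NOT: a kernel-`decide` proof (none known for the 4-block core); separation NOT moved.
-/

namespace Summit.QuantumAdvantage.AdviceFreeQNC0.OddLocal

open Finset

/-! ## S3 — the finite core (planner's `BlockGameK`, restated over `Finset`; `native_decide`) -/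

/-- `Tr(ζ^m · x)` for the code `x ∈ {0,1,2,3}` of `0, ζ⁰, ζ¹, ζ²`. -/
def tr (m : ℕ) (x : ℕ) : Bool := x != 0 && (m + (x - 1)) % 3 != 0

/-- digit `a` (base 4) of a profile code. -/
def dig (p : ℕ) (a : ℕ) : ℕ := (p / 4 ^ a) % 4

/-- win bit of the class cell `(a₀,a₁,a₂,a₃)` under profile codes `p₀,p₁,p₂` and last output `x`. -/
def win4 (p0 p1 p2 : ℕ) (x : ℕ) (a0 a1 a2 a3 : ℕ) : Bool :=
  xor (xor (xor (tr (a1 + a2 + a3) (dig p0 a0)) (tr (2 * a0 + a2 + a3) (dig p1 a1)))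
    (tr (2 * a0 + 2 * a1 + a3) (dig p2 a2))) (tr (2 * a0 + 2 * a1 + 2 * a2) x)

/-- code of an even profile `b : Fin 3 → Bool` (`000 ↦ 0, 011 ↦ 1, 110 ↦ 2, 101 ↦ 3`; odd profiles unused). -/
def enc (b : Fin 3 → Bool) : ℕ :=
  if b 0 = false ∧ b 1 = false ∧ b 2 = false then 0
  else if b 0 = false then 1 else if b 2 = false then 2 else 3

/-- the code of an even profile evaluates back to the profile. -/
theorem tr_enc (b : Fin 3 → Bool) (hb : (xor (xor (b 0) (b 1)) (b 2)) = false) (m : Fin 3) :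
    tr m.val (enc b) = b m := by
  revert b m
  decide

/-- **core** (value 2/3 of the 4-block blind class game, best-response form). -/
theorem core4_le : ∀ p0 p1 p2 : Fin 64,
    (∑ a : Fin 3, (univ : Finset (Fin 4)).sup (fun x => (univ.filter fun w : Fin 3 × Fin 3 × Fin 3 =>
      win4 p0.val p1.val p2.val x.val w.1.val w.2.1.val w.2.2.val a.val = true).card)) ≤ 54 := by
  native_decide -- computational (≈ 85 M Boolean evaluations, ≈ 5 min on the farm; `Lean.ofReduceBool`)

end Summit.QuantumAdvantage.AdviceFreeQNC0.OddLocal
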